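import Mathlib
import Summits.KontsevichZagierPeriods.Zeta5Search.BigPrimeSupport
import HarnessLib

/-!
# ζ(5) search — (W∞) BELOW `b₀`: every prime in `(b₀ − 2b₍₂₎, d(b)+1]` divides the ζ(3)-coefficient `W(b)`

Cell `pub-zeta5` (HONEST FRAMING: systematic search; no irrationality claim unless certified), typer seat
generation 7.  OUR theorem (Summit side; coefficient arithmetic, nothing about irrationality), extending the
big-prime divisibility theorem of `BigPrimeDivisibility.lean` (gen-2 g5 / typer g7, window `(b₀, d+1]`) below `b₀`:

**THEOREM (`one_le_padicValRat_coeffW_of_slot`).**  Let `b ∈ ℤ⁸` lie in the Brown–Zudilin polytope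
(`0 ≤ 2b_j ≤ b₀`, `Σ b_j ≤ 3b₀`), let `j₁` be any slot and `j₂` a slot with `b_{j₂} ≤ b_j` for all `j ≠ j₁` (optimal
choice: `j₁` = a smallest, `j₂` = a second-smallest parameter).  Then every prime `p` with
`max(5, b₀ + 1 − 2b_{j₂}) ≤ p ≤ d(b) + 1` satisfies `v_p(W(b)) ≥ 1`; and (`…_coeffU_of_slot`) `v_p(U(b)) ≥ 1` when moreover
`2p ≤ d(b) + 1`.  Example: on Brown–Zudilin's record ray `b = (41; 17,16,15,14,13,12,11)·m` (`d = 25m`, `b₍₂₎ = 12m`)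
every prime in `(17m, 25m + 1]` divides `W` — a window the `p > b₀` version never reaches.  This is exactly the
range in which the pair-floor terms of the OBSERVED law (WV) (`CasoratianValuation.lean`) vanish and its "top
partners" term is `0`; the typer's exact prototype confirms it on 519 + 290 random `(b, p)` pairs with `p ≤ b₀`.

PROOF = the proof of `BigPrimeDivisibility` run on the support `S = [b_{j₂}, b₀ − b_{j₂}]` with SIX blocks
(`BigPrimeSupport.lean` for the `ℚ`/`ℤ` side): `P_S^6 · M^S = Ñ · (X^p − X)^6` in `𝔽_p[X]` (`pS_pow_mul_MS`) for the
reduced dual polynomial `M^S = (2X+n)·∏_{s∉B_{j₁}}(X+s)·∏_{j≠j₁}K_{β_j}` (`MS`); at a pole `q ∈ S`: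
`z^S_{q,i} ≡ +e^S₀(q)^6·[X^i]M^S(X−q)` (`zS_cast`, `i < 4`, `p ≥ 5`); off `S` the reduced dual polynomial vanishes to
order `6`; `deg M^S + 6n + 5 ≤ 6p + 2Σβ_j` (`natDegree_MS_le`), so `Σ_{x∈𝔽_p}[X^3]M^S(X+x) = 0` as soon as `p ≤ d+1`
(and `[X^1]` for `2p ≤ d+1`).  Requirement `|S| ≤ p` = `b₀ + 1 ≤ p + 2b_{j₂}`.
-/

noncomputable section

open Finset Polynomial

namespace Summit.KontsevichZagierPeriods.Zeta5Search.BigPrime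

open Summit.KontsevichZagierPeriods.Zeta5Search.DualSeries (InBox)
open Summit.KontsevichZagierPeriods.Zeta5Search.WedgeDictionary (IsPFData)

/-! ### The 𝔽_p side with support `S` and six blocks -/

section ModPS

variable {p : ℕ} [hp : Fact p.Prime]

variable (p) in
/-- The support pole factors `P_S = ∏_{s ∈ S} (X + s)`. -/
def pS (n : ℕ) (β : ℕ → ℕ) (j₂ : ℕ) : (ZMod p)[X] := ∏ s ∈ block n (β j₂), (X + C (s : ZMod p))

variable (p) in
/-- The reduced DUAL POLYNOMIAL `M^S = (2X + n) · ∏_{s ∈ [0,n] ∖ B_{j₁}} (X + s) · ∏_{j ≠ j₁} K_{β_j}`. -/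
def MS (n : ℕ) (β : ℕ → ℕ) (j₁ : ℕ) : (ZMod p)[X] :=
  (C 2 * X + C (n : ZMod p)) * (∏ s ∈ range (n + 1) \ block n (β j₁), (X + C (s : ZMod p))) *
    ∏ j ∈ (range 7).erase j₁, KF p n (β j)

/-- For `|S| ≤ p` the elements of the support `S = [β, n − β]` have distinct residues modulo `p`. -/
theorem cast_injOn_block {n β : ℕ} (hS : n + 1 ≤ p + 2 * β) :
    Set.InjOn (Nat.cast : ℕ → ZMod p) (block n β : Finset ℕ) := by
  intro a ha c hc hac
  have ha' : a ∈ block n β := by simpa using ha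
  have hc' : c ∈ block n β := by simpa using hc
  rw [block, mem_Icc] at ha' hc'
  have h := (ZMod.natCast_eq_natCast_iff a c p).1 hac
  refine h.eq_of_abs_lt ?_
  rw [abs_lt]; constructor <;> omega

/-- Wilson duality for one block inside the support: `P_S · K_β = (∏_{s ∈ S ∖ block β} (X + s)) · (X^p − X)`. -/
theorem pS_mul_KF {n : ℕ} {β : ℕ → ℕ} {j₂ : ℕ} (hS : n + 1 ≤ p + 2 * β j₂) {βj : ℕ}
    (hsub : block n βj ⊆ block n (β j₂)) :
    pS p n β j₂ * KF p n βj =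
      (∏ s ∈ block n (β j₂) \ block n βj, (X + C (s : ZMod p))) * (X ^ p - X) := by
  have h1 : pS p n β j₂ = (∏ s ∈ block n (β j₂) \ block n βj, (X + C (s : ZMod p))) *
      ∏ s ∈ block n βj, (X + C (s : ZMod p)) := by
    rw [pS, prod_sdiff hsub]
  have h2 : ∏ s ∈ block n βj, (X + C (s : ZMod p)) = ∏ u ∈ blockF p n βj, (X + C u) := by
    rw [blockF, prod_image ((cast_injOn_block hS).mono (by exact_mod_cast hsub))]
  have h3 : (∏ u ∈ blockF p n βj, (X + C u)) * KF p n βj = X ^ p - X := by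
    rw [KF, mul_comm, prod_sdiff (subset_univ _), prod_univ_X_add_C]
  rw [h1, mul_assoc, h2, h3]

/-- **Wilson duality for the reduced summand**: `P_S^6 · M^S = Ñ · (X^p − X)^6`. -/
theorem pS_pow_mul_MS {n : ℕ} {β : ℕ → ℕ} {j₁ j₂ : ℕ} (hj₁ : j₁ ∈ range 7) (hS : n + 1 ≤ p + 2 * β j₂)
    (hmin : ∀ j ∈ range 7, j ≠ j₁ → β j₂ ≤ β j) :
    pS p n β j₂ ^ 6 * MS p n β j₁ = numS (ZMod p) n β j₁ j₂ * (X ^ p - X) ^ 6 := by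
  have hkey : pS p n β j₂ ^ 6 * ∏ j ∈ (range 7).erase j₁, KF p n (β j) =
      (∏ j ∈ (range 7).erase j₁, ∏ s ∈ block n (β j₂) \ block n (β j), (X + C (s : ZMod p))) *
        (X ^ p - X) ^ 6 := by
    have h6 : pS p n β j₂ ^ 6 = ∏ _j ∈ (range 7).erase j₁, pS p n β j₂ := by
      rw [prod_const, card_erase_of_mem hj₁, card_range]
    rw [h6, ← prod_mul_distrib, prod_congr rfl fun j hj =>
      pS_mul_KF hS (block_mono (hmin j (mem_erase.1 hj).2 (mem_erase.1 hj).1)), prod_mul_distrib,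
      prod_const, card_erase_of_mem hj₁, card_range]
  rw [MS, numS, show pS p n β j₂ ^ 6 * ((C 2 * X + C (n : ZMod p)) *
      (∏ s ∈ range (n + 1) \ block n (β j₁), (X + C (s : ZMod p))) * ∏ j ∈ (range 7).erase j₁, KF p n (β j)) =
    (C 2 * X + C (n : ZMod p)) * (∏ s ∈ range (n + 1) \ block n (β j₁), (X + C (s : ZMod p))) *
      (pS p n β j₂ ^ 6 * ∏ j ∈ (range 7).erase j₁, KF p n (β j)) by ring, hkey]
  ring

/-- Shift of the support factors to a pole `q ∈ S`: `P_S(X − q) = X · ∏_{s ∈ S, s ≠ q} (X + (s − q))`. -/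
theorem taylor_pS {n : ℕ} {β : ℕ → ℕ} {j₂ q : ℕ} (hq : q ∈ block n (β j₂)) :
    taylor (-((q : ℕ) : ZMod p)) (pS p n β j₂) =
      X * ∏ s ∈ (block n (β j₂)).erase q, (X + C ((s : ZMod p) - q)) := by
  rw [pS, taylor_prod', ← mul_prod_erase _ _ hq]
  congr 1
  · rw [taylor_X_add_C, add_neg_cancel, C_0, add_zero]
  · refine prod_congr rfl fun s _ => ?_
    rw [taylor_X_add_C, sub_eq_add_neg]

/-- **The shifted congruence with support `S`**: for `q ∈ S` and `i < 4` (`p ≥ 5`),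
`z^S_{q,i} ≡ e^S₀(q)^6 · [X^i] M^S(X − q) (mod p)`. -/
theorem zS_cast (hp5 : 5 ≤ p) {n : ℕ} {β : ℕ → ℕ} {j₁ j₂ : ℕ} (hj₁ : j₁ ∈ range 7)
    (hS : n + 1 ≤ p + 2 * β j₂) (hmin : ∀ j ∈ range 7, j ≠ j₁ → β j₂ ≤ β j) {q : ℕ}
    (hq : q ∈ block n (β j₂)) {i : ℕ} (hi : i < 4) :
    ((zS n β j₁ j₂ q i : ℤ) : ZMod p) =
      ((eS0 n β j₂ q : ℤ) : ZMod p) ^ 6 * (taylor (-((q : ℕ) : ZMod p)) (MS p n β j₁)).coeff i := by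
  set NF := taylor (-((q : ℕ) : ZMod p)) (numS (ZMod p) n β j₁ j₂) with hNF
  set EF := ES (ZMod p) n β j₂ q with hEF
  set JF := truncInv EF 6 with hJF
  set T := taylor (-((q : ℕ) : ZMod p)) (MS p n β j₁) with hT
  have hshift := congrArg (taylor (-((q : ℕ) : ZMod p))) (pS_pow_mul_MS hj₁ hS hmin)
  simp only [taylor_mul, taylor_pow, taylor_pS hq, taylor_X_pow_card_sub_X] at hshift
  have hXp : (X ^ p - X : (ZMod p)[X]) = X * (X ^ (p - 1) - 1) := by
    have h : (X : (ZMod p)[X]) ^ p = X * X ^ (p - 1) := by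
      rw [← pow_succ', Nat.sub_add_cancel hp.out.one_le]
    rw [h]; ring
  rw [hXp] at hshift
  have hcancel : EF * T = NF * (X ^ (p - 1) - 1) ^ 6 := by
    have h6 : (X : (ZMod p)[X]) ^ 6 ≠ 0 := pow_ne_zero _ X_ne_zero
    apply mul_left_cancel₀ h6
    rw [hEF, ES, prod_pow, hNF, hT]
    linear_combination hshift
  have hY : (X : (ZMod p)[X]) ^ (p - 1) ∣ (X ^ (p - 1) - 1) ^ 6 - 1 := by
    have := sub_dvd_pow_sub_pow (X ^ (p - 1) - 1 : (ZMod p)[X]) (-1) 6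
    rw [sub_neg_eq_add, sub_add_cancel] at this
    refine this.trans (dvd_of_eq ?_)
    ring
  have h4 : (X : (ZMod p)[X]) ^ 4 ∣ X ^ (p - 1) := pow_dvd_pow X (by omega)
  have hA : (X : (ZMod p)[X]) ^ 4 ∣ EF * T - NF := by
    rw [hcancel, show NF * (X ^ (p - 1) - 1) ^ 6 - NF = NF * ((X ^ (p - 1) - 1) ^ 6 - 1) by ring]
    exact (h4.trans hY).mul_left _
  have hB : (X : (ZMod p)[X]) ^ 4 ∣ (EF * JF - C (EF.coeff 0 ^ 6)) * T :=
    ((pow_dvd_pow X (by norm_num : 4 ≤ 6)).trans (truncInv_spec EF 6)).mul_right _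
  have hC : (X : (ZMod p)[X]) ^ 4 ∣ NF * JF - C (EF.coeff 0 ^ 6) * T := by
    have : NF * JF - C (EF.coeff 0 ^ 6) * T = (EF * JF - C (EF.coeff 0 ^ 6)) * T - (EF * T - NF) * JF := by
      ring
    rw [this]
    exact dvd_sub hB (hA.mul_right _)
  have hcoeff := coeff_eq_of_X_pow_dvd_sub hC hi
  have he0 : EF.coeff 0 = ((eS0 n β j₂ q : ℤ) : ZMod p) := by
    rw [hEF, ← ES_map (Int.castRingHom (ZMod p)), coeff_map, ES_coeff_zero]; simp
  have hL : NF * JF = (taylor (-(q : ℤ)) (numS ℤ n β j₁ j₂) * truncInv (ES ℤ n β j₂ q) 6).map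
      (Int.castRingHom (ZMod p)) := by
    rw [Polynomial.map_mul, map_taylor, numS_map, truncInv_map, ES_map]
    simp [hNF, hJF, hEF]
  rw [hL, coeff_map, he0, coeff_C_mul] at hcoeff
  have hz : ((zS n β j₁ j₂ q i : ℤ) : ZMod p) = (Int.castRingHom (ZMod p))
      ((taylor (-(q : ℤ)) (numS ℤ n β j₁ j₂) * truncInv (ES ℤ n β j₂ q) 6).coeff i) := by
    simp [zS]
  rw [hz, hcoeff]

/-- Off the support, `M^S` vanishes to order `6`. -/
theorem X_pow_six_dvd_taylor_MS {n : ℕ} {β : ℕ → ℕ} {j₁ j₂ : ℕ} (hj₁ : j₁ ∈ range 7)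
    (hmin : ∀ j ∈ range 7, j ≠ j₁ → β j₂ ≤ β j) (x : ZMod p)
    (hx : x ∉ (block n (β j₂)).image fun q : ℕ => -((q : ℕ) : ZMod p)) :
    (X : (ZMod p)[X]) ^ 6 ∣ taylor x (MS p n β j₁) := by
  have hK : ∀ j ∈ (range 7).erase j₁, (X : (ZMod p)[X]) ∣ taylor x (KF p n (β j)) := by
    intro j hj
    have hsub : block n (β j) ⊆ block n (β j₂) := block_mono (hmin j (mem_erase.1 hj).2 (mem_erase.1 hj).1)
    have hmem : -x ∈ univ \ blockF p n (β j) := by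
      rw [mem_sdiff]
      refine ⟨mem_univ _, fun h => hx ?_⟩
      rw [blockF, mem_image] at h
      obtain ⟨s, hs, hsx⟩ := h
      exact mem_image.2 ⟨s, hsub hs, by rw [hsx, neg_neg]⟩
    rw [KF, taylor_prod']
    have hfac : taylor x (X + C (-x)) = X := by rw [taylor_X_add_C, neg_add_cancel, C_0, add_zero]
    exact (dvd_of_eq hfac.symm).trans (Finset.dvd_prod_of_mem (fun u : ZMod p => taylor x (X + C u)) hmem)
  rw [MS, taylor_mul, taylor_prod']
  have h6 : (X : (ZMod p)[X]) ^ 6 = ∏ _j ∈ (range 7).erase j₁, (X : (ZMod p)[X]) := by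
    rw [prod_const, card_erase_of_mem hj₁, card_range]
  rw [h6]
  exact (Finset.prod_dvd_prod_of_dvd _ _ hK).mul_left _

end ModPS


/-! ### Pole sum over the support, degree count -/

section ModPS2

variable {p : ℕ} [hp : Fact p.Prime]

/-- The pole sum over `S` IS the full sum over `𝔽_p` (coefficients of order `< 6`). -/
theorem sum_univ_taylor_MS_coeff {n : ℕ} {β : ℕ → ℕ} {j₁ j₂ : ℕ} (hj₁ : j₁ ∈ range 7)
    (hS : n + 1 ≤ p + 2 * β j₂) (hmin : ∀ j ∈ range 7, j ≠ j₁ → β j₂ ≤ β j) {k : ℕ} (hk : k < 6) :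
    ∑ x : ZMod p, (taylor x (MS p n β j₁)).coeff k =
      ∑ q ∈ block n (β j₂), (taylor (-((q : ℕ) : ZMod p)) (MS p n β j₁)).coeff k := by
  have hinj : Set.InjOn (fun q : ℕ => -((q : ℕ) : ZMod p)) (block n (β j₂) : Finset ℕ) := by
    intro a ha c hc hac
    exact cast_injOn_block hS ha hc (neg_inj.1 hac)
  have hzero : ∀ x ∈ (univ : Finset (ZMod p)),
      x ∉ (block n (β j₂)).image (fun q : ℕ => -((q : ℕ) : ZMod p)) → (taylor x (MS p n β j₁)).coeff k = 0 :=
    fun x _ hx => (X_pow_dvd_iff.1 (X_pow_six_dvd_taylor_MS hj₁ hmin x hx)) k hk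
  rw [← sum_subset (subset_univ _) hzero, sum_image hinj]

/-- Degree count for the reduced dual polynomial: `deg M^S + 6n + 5 ≤ 6p + 2 Σ_j β_j`. -/
theorem natDegree_MS_le {n : ℕ} {β : ℕ → ℕ} {j₁ j₂ : ℕ} (hj₁ : j₁ ∈ range 7)
    (hS : n + 1 ≤ p + 2 * β j₂) (hmin : ∀ j ∈ range 7, j ≠ j₁ → β j₂ ≤ β j)
    (hβ : ∀ j ∈ range 7, 2 * β j ≤ n) :
    (MS p n β j₁).natDegree + 6 * n + 5 ≤ 6 * p + 2 * ∑ j ∈ range 7, β j := by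
  have hlin : (C (2 : ZMod p) * X + C (n : ZMod p)).natDegree ≤ 1 := by
    refine (natDegree_add_le _ _).trans (max_le ?_ (by simp))
    exact (natDegree_C_mul_le _ _).trans natDegree_X_le
  have hmid : (∏ s ∈ range (n + 1) \ block n (β j₁), (X + C (s : ZMod p))).natDegree ≤ 2 * β j₁ := by
    refine (natDegree_prod_le _ _).trans ?_
    have hcard : #(range (n + 1) \ block n (β j₁)) = 2 * β j₁ := by
      have h1 := card_sdiff_add_card_eq_card (block_subset n (β j₁))
      rw [block, Nat.card_Icc, card_range] at h1
      have := hβ j₁ hj₁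
      rw [block]
      omega
    simp only [natDegree_X_add_C, sum_const, smul_eq_mul, mul_one, hcard, le_refl]
  have hK : ∀ j ∈ (range 7).erase j₁, (KF p n (β j)).natDegree + (n + 1) ≤ p + 2 * β j := by
    intro j hj
    have hj' := mem_erase.1 hj
    have hb := hβ j hj'.2
    have hsub : block n (β j) ⊆ block n (β j₂) := block_mono (hmin j hj'.2 hj'.1)
    have hcard : #(blockF p n (β j)) = (n - β j) + 1 - β j := by
      rw [blockF, card_image_of_injOn ((cast_injOn_block hS).mono (by exact_mod_cast hsub)), block, Nat.card_Icc]
    have hdeg : (KF p n (β j)).natDegree ≤ p - #(blockF p n (β j)) := by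
      rw [KF]
      refine (natDegree_prod_le _ _).trans ?_
      simp only [natDegree_X_add_C, sum_const, card_univ_sdiff, ZMod.card, smul_eq_mul, mul_one, le_refl]
    rw [hcard] at hdeg
    have hmin' := hmin j hj'.2 hj'.1
    omega
  have hKsum := sum_le_sum hK
  simp only [sum_add_distrib, sum_const, card_erase_of_mem hj₁, card_range, smul_eq_mul] at hKsum
  have hprod : (∏ j ∈ (range 7).erase j₁, KF p n (β j)).natDegree ≤
      ∑ j ∈ (range 7).erase j₁, (KF p n (β j)).natDegree := natDegree_prod_le _ _
  have hMS : (MS p n β j₁).natDegree ≤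
      1 + 2 * β j₁ + ∑ j ∈ (range 7).erase j₁, (KF p n (β j)).natDegree := by
    rw [MS]
    exact (natDegree_mul_le).trans (add_le_add ((natDegree_mul_le).trans (add_le_add hlin hmid)) hprod)
  have h2 : ∑ j ∈ (range 7).erase j₁, 2 * β j = 2 * ∑ j ∈ (range 7).erase j₁, β j := (mul_sum _ _ _).symm
  have h3 : ∑ j ∈ (range 7).erase j₁, β j + β j₁ = ∑ j ∈ range 7, β j := sum_erase_add _ _ hj₁
  omega

end ModPS2

/-! ### Assembly -/

section AssemblyS

/-- The common denominator over the support. -/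
def USall (n : ℕ) (β : ℕ → ℕ) (j₂ : ℕ) : ℤ := ∏ q ∈ block n (β j₂), eS0 n β j₂ q ^ 6

/-- The cleared numerator over the support. -/
def ZSsum (n : ℕ) (β : ℕ → ℕ) (j₁ j₂ i : ℕ) : ℤ :=
  ∑ q ∈ block n (β j₂), zS n β j₁ j₂ q i * ∏ s ∈ (block n (β j₂)).erase q, eS0 n β j₂ s ^ 6

/-- No prime with `|S| ≤ p` divides `U^S`. -/
theorem not_dvd_USall {p : ℕ} (hp : p.Prime) {n : ℕ} {β : ℕ → ℕ} {j₂ : ℕ} (hS : n + 1 ≤ p + 2 * β j₂) :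
    ¬ (p : ℤ) ∣ USall n β j₂ := by
  have hpZ : Prime (p : ℤ) := Nat.prime_iff_prime_int.1 hp
  intro h
  obtain ⟨q, hq, hdvd⟩ := (hpZ.dvd_finsetProd_iff _).1 h
  exact not_dvd_eS0 hp hS hq (hpZ.dvd_of_dvd_pow hdvd)

/-- `U^S · Σ_{q ≤ n} c_{o,q} = Z^S_{5−o}` (the data vanish off `S`). -/
theorem USall_mul_sum_eq (b : ℕ → ℤ) (hb : InBox b) (hhalf : ∀ j ∈ range 7, 2 * b (j + 1) ≤ b 0 + 1)
    {c : ℕ → ℕ → ℚ} (hc : IsPFData b c) {j₁ j₂ : ℕ} (hj₁ : j₁ ∈ range 7)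
    (hmin : ∀ j ∈ range 7, j ≠ j₁ → (b (j₂ + 1)).toNat ≤ (b (j + 1)).toNat) {o : ℕ} (ho : o < 6) :
    (USall (b 0).toNat (fun j => (b (j + 1)).toNat) j₂ : ℚ) * ∑ q ∈ range ((b 0).toNat + 1), c o q =
      (ZSsum (b 0).toNat (fun j => (b (j + 1)).toNat) j₁ j₂ (5 - o) : ℚ) := by
  set n := (b 0).toNat with hn
  set β : ℕ → ℕ := fun j => (b (j + 1)).toNat with hβ
  have hsum : ∑ q ∈ range (n + 1), c o q = ∑ q ∈ block n (β j₂), c o q := by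
    symm
    refine sum_subset (block_subset n (β j₂)) fun q hq hqS => ?_
    exact pf_eq_zero_of_not_mem b hb hhalf hc hj₁ hmin (Nat.lt_succ_iff.1 (mem_range.1 hq)) hqS ho
  rw [hsum, mul_sum, ZSsum]
  push_cast
  refine sum_congr rfl fun q hq => ?_
  rw [USall, ← mul_prod_erase _ _ hq]
  push_cast
  rw [← pf_coeff_eqS b hb hhalf hc hj₁ hmin hq ho]
  ring

/-- `Z^S_i ≡ U^S · Σ_{x ∈ 𝔽_p} [X^i] M^S(X + x) (mod p)` for `i < 4`. -/
theorem ZSsum_cast {p : ℕ} [hp : Fact p.Prime] (hp5 : 5 ≤ p) {n : ℕ} {β : ℕ → ℕ} {j₁ j₂ : ℕ}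
    (hj₁ : j₁ ∈ range 7) (hS : n + 1 ≤ p + 2 * β j₂) (hmin : ∀ j ∈ range 7, j ≠ j₁ → β j₂ ≤ β j)
    {i : ℕ} (hi : i < 4) :
    ((ZSsum n β j₁ j₂ i : ℤ) : ZMod p) =
      ((USall n β j₂ : ℤ) : ZMod p) * ∑ x : ZMod p, (taylor x (MS p n β j₁)).coeff i := by
  rw [sum_univ_taylor_MS_coeff hj₁ hS hmin (by omega), ZSsum, mul_sum]
  push_cast
  refine sum_congr rfl fun q hq => ?_
  rw [zS_cast hp5 hj₁ hS hmin hq hi, USall, ← mul_prod_erase _ _ hq]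
  push_cast
  ring

open Summit.KontsevichZagierPeriods.Zeta5Search.WedgeDictionary (coeffW coeffU coeffW_eq coeffU_eq
  exists_isPFData dOf)

/-- (W∞) below `b₀`, cleared form.  `j₁` = a dropped slot, `j₂` = a slot minimal among the others;
window `max(5, b₀ + 1 − 2b_{j₂}) ≤ p ≤ d(b) + 1`. -/
theorem exists_clear_coeffW_of_slot (b : ℕ → ℤ) (p j₁ j₂ : ℕ) (hb : InBox b)
    (h2 : ∀ i ∈ range 7, 2 * b (i + 1) ≤ b 0) (h3 : ∑ i ∈ range 7, b (i + 1) ≤ 3 * b 0)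
    (hj₁ : j₁ ∈ range 7) (hmin : ∀ j ∈ range 7, j ≠ j₁ → b (j₂ + 1) ≤ b (j + 1))
    (hprime : p.Prime) (hp5 : 5 ≤ p) (hpS : b 0 + 1 ≤ (p : ℤ) + 2 * b (j₂ + 1)) (hpd : (p : ℤ) ≤ dOf b + 1) :
    ∃ U Z : ℤ, ¬ (p : ℤ) ∣ U ∧ (p : ℤ) ∣ Z ∧ (U : ℚ) * coeffW b = Z := by
  haveI : Fact p.Prime := ⟨hprime⟩
  obtain ⟨e0, hS, hβ, hS3⟩ := polytope_data b hb h2 h3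
  have hmin' : ∀ j ∈ range 7, j ≠ j₁ → (b (j₂ + 1)).toNat ≤ (b (j + 1)).toNat :=
    fun j hj hne => Int.toNat_le_toNat (hmin j hj hne)
  have hpS' : (b 0).toNat + 1 ≤ p + 2 * (b (j₂ + 1)).toNat := by
    have := Int.self_le_toNat (b (j₂ + 1)); omega
  have hpd' : p + ∑ j ∈ range 7, (b (j + 1)).toNat ≤ 3 * (b 0).toNat + 1 := by
    have := hpd; rw [dOf, hS, e0] at this; omega
  have hhalf : ∀ j ∈ range 7, 2 * b (j + 1) ≤ b 0 + 1 := fun j hj => by have := h2 j hj; omega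
  obtain ⟨c, hc⟩ := exists_isPFData b hb (by omega)
  refine ⟨_, _, not_dvd_USall hprime hpS', ?_,
    by rw [coeffW_eq hc]; exact USall_mul_sum_eq b hb hhalf hc hj₁ hmin' (by norm_num : 2 < 6)⟩
  rw [← ZMod.intCast_zmod_eq_zero_iff_dvd, ZSsum_cast hp5 hj₁ hpS' hmin' (by norm_num : 3 < 4),
    sum_taylor_coeff_eq_zero (MS p (b 0).toNat (fun j => (b (j + 1)).toNat) j₁) 3 (by omega), mul_zero]
  have := natDegree_MS_le (p := p) hj₁ hpS' hmin' hβ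
  beta_reduce at this
  omega

/-- (U∞) below `b₀`, cleared form (`2p ≤ d(b) + 1`). -/
theorem exists_clear_coeffU_of_slot (b : ℕ → ℤ) (p j₁ j₂ : ℕ) (hb : InBox b)
    (h2 : ∀ i ∈ range 7, 2 * b (i + 1) ≤ b 0) (h3 : ∑ i ∈ range 7, b (i + 1) ≤ 3 * b 0)
    (hj₁ : j₁ ∈ range 7) (hmin : ∀ j ∈ range 7, j ≠ j₁ → b (j₂ + 1) ≤ b (j + 1))
    (hprime : p.Prime) (hp5 : 5 ≤ p) (hpS : b 0 + 1 ≤ (p : ℤ) + 2 * b (j₂ + 1))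
    (hpd : 2 * (p : ℤ) ≤ dOf b + 1) :
    ∃ U Z : ℤ, ¬ (p : ℤ) ∣ U ∧ (p : ℤ) ∣ Z ∧ (U : ℚ) * coeffU b = Z := by
  haveI : Fact p.Prime := ⟨hprime⟩
  obtain ⟨e0, hS, hβ, hS3⟩ := polytope_data b hb h2 h3
  have hmin' : ∀ j ∈ range 7, j ≠ j₁ → (b (j₂ + 1)).toNat ≤ (b (j + 1)).toNat :=
    fun j hj hne => Int.toNat_le_toNat (hmin j hj hne)
  have hpS' : (b 0).toNat + 1 ≤ p + 2 * (b (j₂ + 1)).toNat := by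
    have := Int.self_le_toNat (b (j₂ + 1)); omega
  have hpd' : 2 * p + ∑ j ∈ range 7, (b (j + 1)).toNat ≤ 3 * (b 0).toNat + 1 := by
    have := hpd; rw [dOf, hS, e0] at this; omega
  have hhalf : ∀ j ∈ range 7, 2 * b (j + 1) ≤ b 0 + 1 := fun j hj => by have := h2 j hj; omega
  obtain ⟨c, hc⟩ := exists_isPFData b hb (by omega)
  refine ⟨_, _, not_dvd_USall hprime hpS', ?_,
    by rw [coeffU_eq hc]; exact USall_mul_sum_eq b hb hhalf hc hj₁ hmin' (by norm_num : 4 < 6)⟩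
  rw [← ZMod.intCast_zmod_eq_zero_iff_dvd, ZSsum_cast hp5 hj₁ hpS' hmin' (by norm_num : 1 < 4),
    sum_taylor_coeff_eq_zero (MS p (b 0).toNat (fun j => (b (j + 1)).toNat) j₁) 1 (by omega), mul_zero]
  have := natDegree_MS_le (p := p) hj₁ hpS' hmin' hβ
  beta_reduce at this
  omega

/-- **(W∞) BELOW `b₀`.**  Let `b` lie in the Brown–Zudilin polytope, drop any slot `j₁` and let `j₂` be a slot
whose parameter is minimal among the remaining six.  Then every prime `p` with
`max(5, b₀ + 1 − 2 b_{j₂}) ≤ p ≤ d(b) + 1` divides the ζ(3)-coefficient: `v_p(W(b)) ≥ 1`.  (With `j₂` a slot of the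
second-smallest parameter this is the window `(b₀ − 2b₍₂₎, d+1]`; e.g. on Brown–Zudilin's record ray
`b = (41;17,…,11)·m` it contains every prime in `(17m, 25m+1]`.) -/
theorem one_le_padicValRat_coeffW_of_slot (b : ℕ → ℤ) (p j₁ j₂ : ℕ) (hb : InBox b)
    (h2 : ∀ i ∈ range 7, 2 * b (i + 1) ≤ b 0) (h3 : ∑ i ∈ range 7, b (i + 1) ≤ 3 * b 0)
    (hj₁ : j₁ ∈ range 7) (hmin : ∀ j ∈ range 7, j ≠ j₁ → b (j₂ + 1) ≤ b (j + 1))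
    (hprime : p.Prime) (hp5 : 5 ≤ p) (hpS : b 0 + 1 ≤ (p : ℤ) + 2 * b (j₂ + 1)) (hpd : (p : ℤ) ≤ dOf b + 1)
    (hW : coeffW b ≠ 0) : 1 ≤ padicValRat p (coeffW b) := by
  haveI : Fact p.Prime := ⟨hprime⟩
  obtain ⟨U, Z, hU, hZ, hUW⟩ := exists_clear_coeffW_of_slot b p j₁ j₂ hb h2 h3 hj₁ hmin hprime hp5 hpS hpd
  exact one_le_padicValRat_of_eq hUW hU hZ hW

/-- **(U∞) BELOW `b₀`**: same window condition and `2p ≤ d(b) + 1` give `v_p(U(b)) ≥ 1`. -/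
theorem one_le_padicValRat_coeffU_of_slot (b : ℕ → ℤ) (p j₁ j₂ : ℕ) (hb : InBox b)
    (h2 : ∀ i ∈ range 7, 2 * b (i + 1) ≤ b 0) (h3 : ∑ i ∈ range 7, b (i + 1) ≤ 3 * b 0)
    (hj₁ : j₁ ∈ range 7) (hmin : ∀ j ∈ range 7, j ≠ j₁ → b (j₂ + 1) ≤ b (j + 1))
    (hprime : p.Prime) (hp5 : 5 ≤ p) (hpS : b 0 + 1 ≤ (p : ℤ) + 2 * b (j₂ + 1))
    (hpd : 2 * (p : ℤ) ≤ dOf b + 1) (hU : coeffU b ≠ 0) : 1 ≤ padicValRat p (coeffU b) := by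
  haveI : Fact p.Prime := ⟨hprime⟩
  obtain ⟨U, Z, hU', hZ, hUU⟩ := exists_clear_coeffU_of_slot b p j₁ j₂ hb h2 h3 hj₁ hmin hprime hp5 hpS hpd
  exact one_le_padicValRat_of_eq hUU hU' hZ hU

end AssemblyS

end Summit.KontsevichZagierPeriods.Zeta5Search.BigPrime

end
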